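import Literature.AlgebraicGeometry.Resolution.ArithmeticalThreefoldsLocalSeparableClimb
import Literature.AlgebraicGeometry.Resolution.CofinalityFromPrincipalizationAssembly
import HarnessLib

/-!
# Cossart–Piltant's reduction `(Thm. 1.5) ⇒ (LU for complete local domains)` from principalization and three inputs

Topic: `Literature/AlgebraicGeometry/Resolution`. PROOF side of `CossartPiltant2019ReductionP`
(`ArithmeticalThreefoldsLocal.lean`): the cofinality input (COF) of
`cossartPiltant2019ReductionP_of_parts` (`ArithmeticalThreefoldsLocalSeparableClimb.lean`) is
discharged by the named fact `CossartPiltant2019Principalization` (Cossart–Piltant 2019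
Prop. 4.4 = [CoP1] Prop. 4.2; [CoP1] Cor. 4.6) through `cofinality_of_principalization`
(`CofinalityFromPrincipalizationAssembly.lean`), leaving as hypotheses exactly the three inputs of
the printed proof of Prop. 4.10 that are not yet theorems of the tree: (C3) tame ascent ([CoP1]
Prop. 6.3 for the steps of `Fⁱ ⊆ ⋯ ⊆ Fʳ`), (C4) descent below the ramification field ([CoP1]
Prop. 9.3), (C5) reduction to rank one ([NSp] Thm. 1.1 / [CoP1] Prop. 5.1).

* `cossartPiltant2019ReductionP_of_principalization_of_parts` — PROVED:
  `CossartPiltant2019Local → CossartPiltant2019Principalization → (C3) → (C4) → (C5) →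
  CossartPiltant2019ReductionP`.

Everything is PROVED; no named facts are introduced.

## Sources

* V. Cossart, O. Piltant, J. Algebra 529 (2019) 268–535 = arXiv:1412.0868, Prop. 4.4 and proof of
  Prop. 4.10 (arXiv v1: Prop. 4.3, Prop. 4.8, pp. 53–54). [CossartPiltant2019]
* V. Cossart, O. Piltant, J. Algebra 320 (2008) 1051–1082: Cor. 4.6, Prop. 6.3, Prop. 9.3 (HAL
  hal-00139124: Cor. 4.6, Prop. 8.3, Prop. 9.5). [CossartPiltant2008]
* J. Novacoski, M. Spivakovsky, *Reduction of local uniformization to the rank one case* (2014),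
  Thm. 1.1. [NovacoskiSpivakovsky2014]
-/

noncomputable section

open IsLocalRing Polynomial IntermediateField Module

namespace Literature.AlgebraicGeometry.Resolution

universe u

/-- **Cossart–Piltant 2019, Prop. 4.10 from the local theorem (Thm. 1.5), principalization
(Prop. 4.4) and the inputs (C3) tame ascent, (C4) descent, (C5) reduction to rank one**:
`cossartPiltant2019ReductionP_of_parts` with its cofinality hypothesis discharged by
`cofinality_of_principalization`.
[cite: CossartPiltant2019, proof of Prop. 4.10 (arXiv v1: Prop. 4.8, pp. 53–54) with Prop. 4.4] -/
theorem cossartPiltant2019ReductionP_of_principalization_of_parts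
    (hloc : CossartPiltant2019Local.{u}) (h44 : CossartPiltant2019Principalization.{u})
    (hC3 :
      ∀ (p : ℕ), p.Prime →
      ∀ (S : Type u) [CommRing S] [IsDomain S] [IsRegularLocalRing S],
        IsExcellentRing S → ringKrullDim S = 3 → CharP (ResidueField S) p →
        IsAdicComplete (maximalIdeal S) S →
      ∀ (E : Type u) [Field E] [Algebra S E], Function.Injective (algebraMap S E) →
        IsAlgClosed E → Algebra.IsAlgebraic S E →
      ∀ (OE : ValuationSubring E), (∀ s : S, algebraMap S E s ∈ OE) →
        (∀ s ∈ maximalIdeal S, OE.valuation (algebraMap S E s) < 1) →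
        (∀ y : OE, ∃ q : S[X], (∃ i, q.coeff i ∉ maximalIdeal S) ∧
          OE.valuation (q.eval₂ (algebraMap S E) y) < 1) →
      Nonempty OE.valuation.RankOne →
      ∀ (M : Subfield E), (∀ s : S, algebraMap S E s ∈ M) →
      ∀ (N : IntermediateField M E) [FiniteDimensional M N] [IsGalois M N] (A B : Subfield E),
        (lift (fixedField (inertiaGroupIn OE N))).toSubfield ≤ A →
        B ≤ (lift (fixedField (ramificationGroupIn OE N))).toSubfield →
        IsPrimeGaloisStep p A B →
        (∃ t : Finset E, (t : Set E) ⊆ A ∧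
          A ≤ Subfield.closure (Set.range (algebraMap S E) ∪ (t : Set E)) ∧
          ∃ hTO : (Algebra.adjoin S (t : Set E)).toSubring ≤ OE.toSubring,
            IsRegularLocalRing (Localization.AtPrime
              (Ideal.comap (Subring.inclusion hTO) (maximalIdeal OE)))) →
        (∃ t : Finset E, (t : Set E) ⊆ B ∧
          B ≤ Subfield.closure (Set.range (algebraMap S E) ∪ (t : Set E)) ∧
          ∃ hTO : (Algebra.adjoin S (t : Set E)).toSubring ≤ OE.toSubring,
            IsRegularLocalRing (Localization.AtPrime
              (Ideal.comap (Subring.inclusion hTO) (maximalIdeal OE)))))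
    (hC4 :
      ∀ (p : ℕ), p.Prime →
      ∀ (S : Type u) [CommRing S] [IsDomain S] [IsRegularLocalRing S],
        IsExcellentRing S → ringKrullDim S = 3 → CharP (ResidueField S) p →
        IsAdicComplete (maximalIdeal S) S →
      ∀ (E : Type u) [Field E] [Algebra S E], Function.Injective (algebraMap S E) →
        IsAlgClosed E → Algebra.IsAlgebraic S E →
      ∀ (OE : ValuationSubring E), (∀ s : S, algebraMap S E s ∈ OE) →
        (∀ s ∈ maximalIdeal S, OE.valuation (algebraMap S E s) < 1) →
        (∀ y : OE, ∃ q : S[X], (∃ i, q.coeff i ∉ maximalIdeal S) ∧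
          OE.valuation (q.eval₂ (algebraMap S E) y) < 1) →
      Nonempty OE.valuation.RankOne →
      ∀ (M : Subfield E), (∀ s : S, algebraMap S E s ∈ M) →
      ∀ (N : IntermediateField M E) [FiniteDimensional M N] [IsGalois M N] (K' : Subfield E),
        M ≤ K' → K' ≤ (lift (fixedField (ramificationGroupIn OE N))).toSubfield →
        (∃ t : Finset E, (t : Set E) ⊆ K' ∧
          K' ≤ Subfield.closure (Set.range (algebraMap S E) ∪ (t : Set E)) ∧
          ∃ hTO : (Algebra.adjoin S (t : Set E)).toSubring ≤ OE.toSubring,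
            IsRegularLocalRing (Localization.AtPrime
              (Ideal.comap (Subring.inclusion hTO) (maximalIdeal OE)))) →
        (∃ t : Finset E, (t : Set E) ⊆ M ∧
          M ≤ Subfield.closure (Set.range (algebraMap S E) ∪ (t : Set E)) ∧
          ∃ hTO : (Algebra.adjoin S (t : Set E)).toSubring ≤ OE.toSubring,
            IsRegularLocalRing (Localization.AtPrime
              (Ideal.comap (Subring.inclusion hTO) (maximalIdeal OE)))))
    (hC5 :
      ∀ (p : ℕ), p.Prime →
      ∀ (S : Type u) [CommRing S] [IsDomain S] [IsRegularLocalRing S],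
        IsExcellentRing S → ringKrullDim S = 3 → CharP (ResidueField S) p →
        IsAdicComplete (maximalIdeal S) S →
      ∀ (E : Type u) [Field E] [Algebra S E], Function.Injective (algebraMap S E) →
        IsAlgClosed E → Algebra.IsAlgebraic S E →
      (∀ (OE : ValuationSubring E), Nonempty OE.valuation.RankOne →
        (∀ s : S, algebraMap S E s ∈ OE) →
        (∀ s ∈ maximalIdeal S, OE.valuation (algebraMap S E s) < 1) →
        (∀ y : OE, ∃ q : S[X], (∃ i, q.coeff i ∉ maximalIdeal S) ∧
          OE.valuation (q.eval₂ (algebraMap S E) y) < 1) →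
        ∀ s₀ : Finset E, ∃ t : Finset E,
            (t : Set E) ⊆ Subfield.closure (Set.range (algebraMap S E) ∪ (s₀ : Set E)) ∧
            (s₀ : Set E) ⊆ Subfield.closure (Set.range (algebraMap S E) ∪ (t : Set E)) ∧
            ∃ hTO : (Algebra.adjoin S (t : Set E)).toSubring ≤ OE.toSubring,
              IsRegularLocalRing (Localization.AtPrime
                (Ideal.comap (Subring.inclusion hTO) (maximalIdeal OE)))) →
      ∀ (OE : ValuationSubring E), (∀ s : S, algebraMap S E s ∈ OE) →
        (∀ s ∈ maximalIdeal S, OE.valuation (algebraMap S E s) < 1) →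
        (∀ y : OE, ∃ q : S[X], (∃ i, q.coeff i ∉ maximalIdeal S) ∧
          OE.valuation (q.eval₂ (algebraMap S E) y) < 1) →
        ∀ s₀ : Finset E, ∃ t : Finset E,
            (t : Set E) ⊆ Subfield.closure (Set.range (algebraMap S E) ∪ (s₀ : Set E)) ∧
            (s₀ : Set E) ⊆ Subfield.closure (Set.range (algebraMap S E) ∪ (t : Set E)) ∧
            ∃ hTO : (Algebra.adjoin S (t : Set E)).toSubring ≤ OE.toSubring,
              IsRegularLocalRing (Localization.AtPrime
                (Ideal.comap (Subring.inclusion hTO) (maximalIdeal OE)))) :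
    CossartPiltant2019ReductionP.{u} :=
  cossartPiltant2019ReductionP_of_parts hloc
    (fun p hp S _ _ _ hS hSdim hSchar hScomp E _ _ hinj hE halg =>
      cofinality_of_principalization h44 p hp S hS hSdim hSchar hScomp E hinj hE halg)
    hC3 hC4 hC5

end Literature.AlgebraicGeometry.Resolution

end
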